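import Summits.MatrixMultiplication.MatrixMultiplication.Theorems.AbelianSTPPCensusTAStatEDefs

/-!
# T_A static certificate, range `6380 … 6779` (t*-indexed linear checker with the k-member tree at `τ = 2371/1000`): kernel evaluation, the shape checks of the tree-heavy volumes `3808`, `3822` on the order sub-range(s) `6380 … 6519`, `6520 … 6630`, `6631 … 6770`, `6727 … 6779` (one theorem per (volume, sub-range): bounded kernel memory)

Cell mm-stpp (rung F-M1), tier T_A = «beat `2.371`, the record exponent (ADVXXZ'25 / DEK+26 rounded)»; checker in `AbelianSTPPCensusTAStatEDefs.lean`, table and bucket lists in `AbelianSTPPCensusTAStatEData.lean`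
(pattern: theory g12's `AbelianSTPPCensusTAStatDDom*/DCk*.lean`).  `decide` with kernel reduction (standard axioms; no `native_decide`), `Elab.async false`;
consumed by `TAStatE.checkV_sound` / `TAStatE.domV_sound` / `TAStatE.m2V_sound` in the leaf `AbelianSTPPCensusLeafTA6779Closed.lean`.
WHAT THIS IS NOT: arithmetic on shape lists only; no statement about STPP families or `ω`.
-/

set_option linter.dupNamespace false
set_option autoImplicit false
set_option Elab.async false

namespace Summit.MatrixMultiplication.MatrixMultiplication.Theorems.TAStatE

set_option maxHeartbeats 0 in
/-- Heavy volume `3808` (32 shapes; 131653 tree nodes over all orders), orders `6727 … 6779`: every sorted candidate shape passes `checkShape 6727 6779`. [original] -/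
theorem ck3808r4 : TAStatE.checkV 6727 6779 1 3808 = true := by decide +kernel

set_option maxHeartbeats 0 in
/-- Heavy volume `3822` (27 shapes; 55239 tree nodes over all orders), orders `6380 … 6519`: every sorted candidate shape passes `checkShape 6380 6519`. [original] -/
theorem ck3822r0 : TAStatE.checkV 6380 6519 1 3822 = true := by decide +kernel

set_option maxHeartbeats 0 in
/-- Heavy volume `3822` (27 shapes; 55239 tree nodes over all orders), orders `6520 … 6630`: every sorted candidate shape passes `checkShape 6520 6630`. [original] -/
theorem ck3822r1 : TAStatE.checkV 6520 6630 1 3822 = true := by decide +kernel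

set_option maxHeartbeats 0 in
/-- Heavy volume `3822` (27 shapes; 55239 tree nodes over all orders), orders `6631 … 6770`: every sorted candidate shape passes `checkShape 6631 6770`. [original] -/
theorem ck3822r2 : TAStatE.checkV 6631 6770 1 3822 = true := by decide +kernel

end Summit.MatrixMultiplication.MatrixMultiplication.Theorems.TAStatE
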